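import Literature.NumberTheory.EllipticCurves.IsogenyDegreeOneProofs
import Literature.NumberTheory.EllipticCurves.IsogenySeparableFactorProofs
import Literature.NumberTheory.EllipticCurves.IsogenyXRationalFunctionProofs
import HarnessLib

/-!
# Uniqueness of the quotient curve `E/Φ` up to a change of variables (Silverman, *AEC*, Prop. III.4.12)

A *proofs* file (theorems only; no definition, no named fact, no instance).  The tree's quotient package
`WeierstrassCurve.exists_isogeny_ker_eq_and_comp_eq_nsmul` (`IsogenyQuotient`, discharged in
`IsogenyQuotientCurveProofs`) gives the EXISTENCE half of Silverman, *AEC*, Prop. III.4.12 ("there are a unique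
elliptic curve `E'` and a separable isogeny `φ : E → E'` satisfying `ker φ = Φ`"); this file proves the UNIQUENESS
half over a number field `K`, in the only form meaningful for Weierstrass equations:

* `WeierstrassCurve.Isogeny.exists_variableChange_eq_of_ker_eq` — two isogenies `g₁ : W → V₁`, `g₂ : W → V₂` of elliptic
  curves over `K` with the same kernel on `K̄`-points have `K`-isomorphic targets: `C • V₁ = V₂` for a change of
  variables `C` over `K`.

Proof: `g₂ = λ ∘ g₁` for an isogeny `λ : V₁ → V₂` over `K` (AEC Cor. III.4.11, the tree's
`Isogeny.exists_eq_comp_of_ker_le`; every isogeny is separable in characteristic `0`, `Isogeny.degree_eq_deg`), `λ` has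
trivial kernel (`g₁` is onto, AEC II.2.3), hence degree `1`, hence is a change of variables
(`Isogeny.exists_variableChange_eq_of_degree_eq_one`, AEC II.2.4.1 / III.3.1(b)).

## References

* [SilvermanAEC2009] J. H. Silverman, *The Arithmetic of Elliptic Curves*, 2nd ed., GTM 106 (2009), Prop. III.4.12,
  Cor. III.4.11, Thm. II.2.3, II.2.4.1, Prop. III.3.1(b).

## Design

`noncomputable section`, `open scoped Classical`, dot-notation extensions in `namespace WeierstrassCurve.Isogeny` as the
sibling isogeny proofs files; number-field generality (that of `IsogenyDegreeOneProofs`).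
-/

noncomputable section

open scoped Classical

universe u

namespace WeierstrassCurve

namespace Isogeny

variable {K : Type u} [Field K] [NumberField K] {W V₁ V₂ : WeierstrassCurve K}
  [W.IsElliptic] [V₁.IsElliptic] [V₂.IsElliptic]

omit [NumberField K] [V₂.IsElliptic] in
/-- **An isogeny through which another isogeny with the same kernel factors has degree one.**  If `g₂ = λ ∘ g₁` on
`K̄`-points and `ker g₂ ⊆ ker g₁`, then `#ker λ = 1` (`g₁` is onto, Silverman *AEC* Thm. II.2.3).
[cite: SilvermanAEC2009, Thm. II.2.3 and Cor. III.4.11] -/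
theorem degree_eq_one_of_comp_eq (g₁ : Isogeny W V₁) (g₂ : Isogeny W V₂) (lam : Isogeny V₁ V₂)
    (hcomp : ∀ P, g₂ P = lam (g₁ P)) (hker : ∀ P, g₂ P = 0 → g₁ P = 0) : lam.degree = 1 := by
  unfold Isogeny.degree
  have hbot : lam.toAddMonoidHom.ker = ⊥ := by
    refine (AddSubgroup.eq_bot_iff_forall _).mpr fun Q hQ ↦ ?_
    obtain ⟨P, rfl⟩ := g₁.surjective Q
    have h2 : g₂ P = 0 := by rw [hcomp]; exact (AddMonoidHom.mem_ker).mp hQ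
    exact hker P h2
  rw [hbot, AddSubgroup.card_bot]

/-- **Uniqueness of the quotient curve (Silverman, *AEC*, Prop. III.4.12) over a number field.**  Two isogenies
`g₁ : W → V₁`, `g₂ : W → V₂` of elliptic curves over a number field `K` with the same kernel on `K̄`-points have
`K`-isomorphic targets: `C • V₁ = V₂` for an admissible change of variables `C` over `K` (factor `g₂ = λ ∘ g₁` by
Cor. III.4.11, `λ` has degree `1`, and a degree-one isogeny is a change of variables, II.2.4.1 / III.3.1(b)).
[cite: SilvermanAEC2009, Prop. III.4.12 (uniqueness) with Cor. III.4.11] -/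
theorem exists_variableChange_eq_of_ker_eq (g₁ : Isogeny W V₁) (g₂ : Isogeny W V₂)
    (hker : ∀ P, g₁ P = 0 ↔ g₂ P = 0) : ∃ C : VariableChange K, C • V₁ = V₂ := by
  have hsep : g₁.deg ≤ Nat.card g₁.toAddMonoidHom.ker := le_of_eq (Isogeny.degree_eq_deg g₁).symm
  obtain ⟨lam, hlam⟩ := g₁.exists_eq_comp_of_ker_le g₂ hsep fun P hP ↦ (hker P).mp hP
  exact lam.exists_variableChange_eq_of_degree_eq_one
    (degree_eq_one_of_comp_eq g₁ g₂ lam hlam fun P hP ↦ (hker P).mpr hP)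

/-- Kernel-as-subgroup form of `exists_variableChange_eq_of_ker_eq`. [cite: SilvermanAEC2009, Prop. III.4.12 (uniqueness)] -/
theorem exists_variableChange_eq_of_ker_eq' (g₁ : Isogeny W V₁) (g₂ : Isogeny W V₂)
    (hker : g₁.toAddMonoidHom.ker = g₂.toAddMonoidHom.ker) : ∃ C : VariableChange K, C • V₁ = V₂ :=
  exists_variableChange_eq_of_ker_eq g₁ g₂ fun P ↦ by
    have h1 : g₁ P = 0 ↔ P ∈ g₁.toAddMonoidHom.ker := (AddMonoidHom.mem_ker).symm
    have h2 : g₂ P = 0 ↔ P ∈ g₂.toAddMonoidHom.ker := (AddMonoidHom.mem_ker).symm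
    rw [h1, h2, hker]

end Isogeny

end WeierstrassCurve

end
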